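import Literature.Analysis.Calculus.SmoothCutoff
import Literature.NumberTheory.Sieve.GreenTao2008PseudorandomMajorantProofs

/-!
# Crux `WindowedShellChannels` (stmt-FinalStateConjecture-14085), line `Sketch` — stub `stub_layerSplit`,
# part 1: `|S′| ≤ 2` for Mathlib's smooth transition, and the zone cutoff

Support file for `stub_layerSplit σ` (the pigeonhole layer split with a data-poor gap), which
cuts Cauchy data with a smooth partition of unity `χz + χn + χf + χg = 1` built from
`S = Real.smoothTransition` (part 2, `…StubLayerSplitCutoffs`).  The energy cost of a cut is
controlled by `χ′²`, so an EXPLICIT bound on `S′` is needed: `0 ≤ S′ ≤ 2`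
(`layerSplit_deriv_smoothTransition`, re-exporting the tree's
`Literature.NumberTheory.Sieve.GreenTao2008.deriv_smoothTransition_nonneg/le_two`),
and the ZONE cutoff `χz(x) = S(x/L + 2)·S(2 − x/L)` (`= 1` on `[−L, L]`, `= 0` off `(−2L, 2L)`,
`|χz′| ≤ 2/L`, `χz′ = 0` off `L < |x| < 2L`, hence `χz′² ≤ 16/x²`).  The cutoff is not a
definition: every lemma takes its defining equation `hz : χz = fun x => …` as a hypothesis.
[folklore]
-/

noncomputable section

set_option linter.dupNamespace false

namespace Summit.FinalStateConjecture.FinalStateConjecture.Theorems.WindowedShellChannelsSketch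

namespace LayerSplit

open Real Set Literature.Analysis.Calculus Literature.NumberTheory.Sieve

/-! ### The derivative of `Real.smoothTransition` -/

/-- `|S'| ≤ 2`. [folklore] -/
theorem abs_deriv_smoothTransition_le_two (x : ℝ) : |deriv Real.smoothTransition x| ≤ 2 := by
  rw [abs_of_nonneg (GreenTao2008.deriv_smoothTransition_nonneg x)]
  exact GreenTao2008.deriv_smoothTransition_le_two x

/-- `d² ≤ 16/x²` from `|d| ≤ D`, `|x| ≤ M`, `D·M ≤ 4`, `x ≠ 0` (the scale-invariant form of the
transition costs). [folklore] -/
theorem sq_le_sixteen_div_sq {d x D M : ℝ} (hd : |d| ≤ D) (hM : |x| ≤ M) (hDM : D * M ≤ 4)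
    (hx0 : x ≠ 0) : d ^ 2 ≤ 16 / x ^ 2 := by
  have hD : 0 ≤ D := (abs_nonneg d).trans hd
  have hx2 : 0 < x ^ 2 := by positivity
  rw [le_div_iff₀ hx2]
  have h1 : |d| * |x| ≤ D * M := mul_le_mul hd hM (abs_nonneg x) hD
  have h2 : 0 ≤ |d| * |x| := by positivity
  calc d ^ 2 * x ^ 2 = (|d| * |x|) ^ 2 := by rw [mul_pow, sq_abs, sq_abs]
    _ ≤ (D * M) ^ 2 := pow_le_pow_left₀ h2 h1 2
    _ ≤ 4 ^ 2 := pow_le_pow_left₀ (h2.trans h1) hDM 2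
    _ = 16 := by norm_num

/-! ### The zone cutoff `χz(x) = S(x/L + 2)·S(2 − x/L)` -/

section Zone

variable {χz : ℝ → ℝ} {L x : ℝ}

/-- `χz` is smooth. [folklore] -/
theorem contDiff_chiZ (hz : χz = fun x => smoothTransition (x / L + 2) * smoothTransition (2 - x / L)) :
    ContDiff ℝ (⊤ : ℕ∞) χz :=
  hz ▸ (smoothTransition.contDiff.comp ((contDiff_id.div_const L).add contDiff_const)).mul
    (smoothTransition.contDiff.comp (contDiff_const.sub (contDiff_id.div_const L)))

/-- `0 ≤ χz`. [folklore] -/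
theorem chiZ_nonneg (hz : χz = fun x => smoothTransition (x / L + 2) * smoothTransition (2 - x / L))
    (x : ℝ) : 0 ≤ χz x := by
  subst hz
  exact mul_nonneg (smoothTransition.nonneg _) (smoothTransition.nonneg _)

/-- `χz ≤ 1`. [folklore] -/
theorem chiZ_le_one (hz : χz = fun x => smoothTransition (x / L + 2) * smoothTransition (2 - x / L))
    (x : ℝ) : χz x ≤ 1 := by
  subst hz
  exact mul_le_one₀ (smoothTransition.le_one _) (smoothTransition.nonneg _) (smoothTransition.le_one _)

/-- `χz = 1` on `[−L, L]`. [folklore] -/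
theorem chiZ_eq_one (hz : χz = fun x => smoothTransition (x / L + 2) * smoothTransition (2 - x / L))
    (hL : 0 < L) (hx : |x| ≤ L) : χz x = 1 := by
  subst hz
  obtain ⟨h1, h2⟩ := abs_le.1 hx
  have h3 : -1 ≤ x / L := by rw [le_div_iff₀ hL]; linarith
  have h4 : x / L ≤ 1 := by rw [div_le_iff₀ hL]; linarith
  show smoothTransition (x / L + 2) * smoothTransition (2 - x / L) = 1
  rw [smoothTransition.one_of_one_le (by linarith), smoothTransition.one_of_one_le (by linarith),
    mul_one]

/-- `χz = 0` on `{2L ≤ |x|}`. [folklore] -/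
theorem chiZ_eq_zero (hz : χz = fun x => smoothTransition (x / L + 2) * smoothTransition (2 - x / L))
    (hL : 0 < L) (hx : 2 * L ≤ |x|) : χz x = 0 := by
  subst hz
  show smoothTransition (x / L + 2) * smoothTransition (2 - x / L) = 0
  rcases le_abs'.1 hx with h | h
  · have h3 : x / L ≤ -2 := by rw [div_le_iff₀ hL]; linarith
    rw [smoothTransition.zero_of_nonpos (by linarith), zero_mul]
  · have h3 : 2 ≤ x / L := by rw [le_div_iff₀ hL]; linarith
    rw [smoothTransition.zero_of_nonpos (show 2 - x / L ≤ 0 by linarith), mul_zero]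

/-- The derivative of `χz`. [folklore] -/
theorem hasDerivAt_chiZ (hz : χz = fun x => smoothTransition (x / L + 2) * smoothTransition (2 - x / L))
    (x : ℝ) :
    HasDerivAt χz
      (deriv smoothTransition (x / L + 2) * (1 / L) * smoothTransition (2 - x / L)
        + smoothTransition (x / L + 2) * (deriv smoothTransition (2 - x / L) * (-(1 / L)))) x := by
  subst hz
  have h1 : HasDerivAt (fun y : ℝ => y / L + 2) (1 / L) x :=
    ((hasDerivAt_id' x).div_const L).add_const 2
  have h2 : HasDerivAt (fun y : ℝ => 2 - y / L) (-(1 / L)) x :=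
    ((hasDerivAt_id' x).div_const L).const_sub 2
  have hS1 : HasDerivAt (fun y => smoothTransition (y / L + 2))
      (deriv smoothTransition (x / L + 2) * (1 / L)) x :=
    ((differentiable_smoothTransition _).hasDerivAt).comp x h1
  have hS2 : HasDerivAt (fun y => smoothTransition (2 - y / L))
      (deriv smoothTransition (2 - x / L) * (-(1 / L))) x :=
    ((differentiable_smoothTransition _).hasDerivAt).comp x h2
  exact hS1.mul hS2

/-- The derivative of `χz`, `deriv` form. [folklore] -/
theorem deriv_chiZ (hz : χz = fun x => smoothTransition (x / L + 2) * smoothTransition (2 - x / L))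
    (x : ℝ) : deriv χz x =
    deriv smoothTransition (x / L + 2) / L * smoothTransition (2 - x / L)
      - smoothTransition (x / L + 2) * deriv smoothTransition (2 - x / L) / L := by
  rw [(hasDerivAt_chiZ hz x).deriv]; ring

/-- `|χz′| ≤ 2/L` (only one factor varies at a time). [folklore] -/
theorem abs_deriv_chiZ_le (hz : χz = fun x => smoothTransition (x / L + 2) * smoothTransition (2 - x / L))
    (hL : 0 < L) (x : ℝ) : |deriv χz x| ≤ 2 / L := by
  rw [deriv_chiZ hz]
  rcases le_or_gt 0 x with hx | hx
  · have h1 : 1 ≤ x / L + 2 := by have : 0 ≤ x / L := div_nonneg hx hL.le; linarith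
    rw [deriv_smoothTransition_of_one_le h1, zero_div, zero_mul, zero_sub, abs_neg,
      abs_div, abs_mul, abs_of_pos hL, abs_of_nonneg (smoothTransition.nonneg _)]
    refine div_le_div_of_nonneg_right ?_ hL.le
    calc smoothTransition (x / L + 2) * |deriv smoothTransition (2 - x / L)|
        ≤ 1 * 2 := mul_le_mul (smoothTransition.le_one _) (abs_deriv_smoothTransition_le_two _)
          (abs_nonneg _) zero_le_one
      _ = 2 := one_mul _
  · have h1 : 1 ≤ 2 - x / L := by
      have : x / L ≤ 0 := div_nonpos_of_nonpos_of_nonneg hx.le hL.le; linarith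
    rw [deriv_smoothTransition_of_one_le h1, mul_zero, zero_div, sub_zero, div_mul_eq_mul_div,
      abs_div, abs_mul, abs_of_pos hL, abs_of_nonneg (smoothTransition.nonneg (2 - x / L))]
    refine div_le_div_of_nonneg_right ?_ hL.le
    calc |deriv smoothTransition (x / L + 2)| * smoothTransition (2 - x / L) ≤ 2 * 1 :=
          mul_le_mul (abs_deriv_smoothTransition_le_two _) (smoothTransition.le_one _)
            (smoothTransition.nonneg _) zero_le_two
      _ = 2 := mul_one _

/-- `χz′ = 0` on `{|x| ≤ L}` and on `{2L ≤ |x|}`. [folklore] -/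
theorem deriv_chiZ_eq_zero (hz : χz = fun x => smoothTransition (x / L + 2) * smoothTransition (2 - x / L))
    (hL : 0 < L) (hx : |x| ≤ L ∨ 2 * L ≤ |x|) : deriv χz x = 0 := by
  rw [deriv_chiZ hz]
  have key : (x / L + 2 ≤ 0 ∨ 1 ≤ x / L + 2) ∧ (2 - x / L ≤ 0 ∨ 1 ≤ 2 - x / L) := by
    rcases hx with hx | hx
    · obtain ⟨h1, h2⟩ := abs_le.1 hx
      have h3 : -1 ≤ x / L := by rw [le_div_iff₀ hL]; linarith
      have h4 : x / L ≤ 1 := by rw [div_le_iff₀ hL]; linarith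
      exact ⟨Or.inr (by linarith), Or.inr (by linarith)⟩
    · rcases le_abs'.1 hx with h | h
      · have h3 : x / L ≤ -2 := by rw [div_le_iff₀ hL]; linarith
        exact ⟨Or.inl (by linarith), Or.inr (by linarith)⟩
      · have h3 : 2 ≤ x / L := by rw [le_div_iff₀ hL]; linarith
        exact ⟨Or.inr (by linarith), Or.inl (by linarith)⟩
  rw [key.1.elim deriv_smoothTransition_of_nonpos deriv_smoothTransition_of_one_le,
    key.2.elim deriv_smoothTransition_of_nonpos deriv_smoothTransition_of_one_le]
  ring

/-- `χz′(x) ≠ 0` only on the transition `L < |x| < 2L`. [folklore] -/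
theorem trans_of_deriv_chiZ_ne_zero
    (hz : χz = fun x => smoothTransition (x / L + 2) * smoothTransition (2 - x / L))
    (hL : 0 < L) (h : deriv χz x ≠ 0) : L < |x| ∧ |x| < 2 * L := by
  by_contra hc
  rw [not_and_or, not_lt, not_lt] at hc
  exact h (deriv_chiZ_eq_zero hz hL hc)

/-- **`χz′² ≤ 16/x²`** everywhere. [folklore] -/
theorem deriv_chiZ_sq_le (hz : χz = fun x => smoothTransition (x / L + 2) * smoothTransition (2 - x / L))
    (hL : 0 < L) (x : ℝ) : deriv χz x ^ 2 ≤ 16 / x ^ 2 := by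
  by_cases h : deriv χz x = 0
  · rw [h, sq, mul_zero]; positivity
  · obtain ⟨h1, h2⟩ := trans_of_deriv_chiZ_ne_zero hz hL h
    have hx0 : x ≠ 0 := by intro h0; rw [h0, abs_zero] at h1; linarith
    have e : 2 / L * (2 * L) = 4 := by field_simp; ring
    exact sq_le_sixteen_div_sq (abs_deriv_chiZ_le hz hL x) h2.le e.le hx0

end Zone

end LayerSplit

/-- **Registered principal fact of this support file** (stub `stub_layerSplit`, line `Sketch`):
the derivative of Mathlib's `Real.smoothTransition` satisfies `0 ≤ S′ ≤ 2` everywhere — the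
explicit constant behind the `16/x²` transition costs of the layer split. [folklore] -/
theorem layerSplit_deriv_smoothTransition :
    ∀ x : ℝ, 0 ≤ deriv Real.smoothTransition x ∧ deriv Real.smoothTransition x ≤ 2 :=
  fun x => ⟨Literature.NumberTheory.Sieve.GreenTao2008.deriv_smoothTransition_nonneg x,
    Literature.NumberTheory.Sieve.GreenTao2008.deriv_smoothTransition_le_two x⟩

end Summit.FinalStateConjecture.FinalStateConjecture.Theorems.WindowedShellChannelsSketch

end
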